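import Literature.Topology.FourManifolds.LatticeFormsNegTwoDVectorOrthogonal
import Literature.Topology.FourManifolds.LatticeFormsPolarisationTypesSplitNonsplit
import HarnessLib

/-!
# The orthogonal complement of a `(−2d)`-vector of `L_{2d}^{(m)} = 2U ⊕ mE₈(−1) ⊕ ⟨−2d⟩`, for all `m`, and in the
# standalone model (Gritsenko–Hulek–Sankaran, Doc. Math. 13 (2008), Prop. 2.4 (iii); Invent. Math. 169 (2007), Prop. 4.6)

## Source (verbatim)

Gritsenko–Hulek–Sankaran, *Hirzebruch–Mumford proportionality and locally symmetric varieties of orthogonal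
type*, Doc. Math. 13 (2008) 1–19, §2, with `L_{2d}^{(m)} = 2U ⊕ mE₈(−1) ⊕ ⟨−2d⟩` (of signature `(2, 8m + 3)`),
Proposition 2.4: "Suppose `d` is a positive integer. […] (iii) The orthogonal complement of a `(−2d)`-vector `r`
in `L_{2d}^{(m)}` is isometric to `II_{2,8m+2} = 2U ⊕ mE₈(−1)` if `div(r) = 2d`, and to
`K_2^{(m)} = U ⊕ mE₈(−1) ⊕ ⟨2⟩ ⊕ ⟨−2⟩` or `T_{2,8m+2} = U ⊕ U(2) ⊕ mE₈(−1)` if `div(r) = d`." Proof: "iii) This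
was proved in [GHS2] for `m = 2`. For general `m` the proof is the same."

[GHS2] = Gritsenko–Hulek–Sankaran, *The Kodaira dimension of the moduli of K3 surfaces*, Invent. Math. 169
(2007), §4 (arXiv numbering) Prop. 4.6 and its proof: for `h ∈ L_{K3} = 3U ⊕ 2E₈(−1)` primitive with `h² = 2d`,
`L_{2d} = h^⊥`, `r ∈ L_{2d}` primitive with `r² = −2d` ("then `div(r) = d` or `2d`"), `L_r = r^⊥_{L_{2d}}`,
`S_r = (L_r)^⊥_{L_{K3}}` the rank-two lattice containing `ℤh ⊕ ℤr`; "`L_r ≅ 2U ⊕ 2E₈(−1)` if `div(r) = 2d`";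
"`S_r ≅ U(2)` if `δ_{S_r} = 0`, `⟨2⟩ ⊕ ⟨−2⟩` if `δ_{S_r} = 1`" and correspondingly
`L_r ≅ U ⊕ 2E₈(−1) ⊕ U(2)` or `U ⊕ 2E₈(−1) ⊕ ⟨2⟩ ⊕ ⟨−2⟩` if `div(r) = d`. The tree holds this `m = 2` case
(for an abstract even unimodular `Λ` of rank `22` and signature `−16`) as
`restrict_orthogonal_span_pair_equivalent_of_two_mul_dvd`, `…_or_of_not_two_mul_dvd`, `…_of_deltaInvariant`
(`LatticeFormsNegTwoDVectorOrthogonal`), on top of the invariants of `L_r` computed in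
`LatticeFormsNegTwoDVectorOrthogonalTwoElementary`, which are already stated for arbitrary rank.

## What this file proves (theorems only; no new definitions, no named facts)

* §1 "for general `m` the proof is the same": for an even unimodular `Λ` of rank `8m + 6` and signature `−8m`
  (the genus of `II_{3,8m+3} = 3U ⊕ mE₈(−1)`), `ℓ ∈ Λ` primitive with `ℓ² = 2d > 0`, `r ⊥ ℓ` primitive in `Λ` with
  `r² = −2d` and `d ∣ (r, w)` for all `w ⊥ ℓ`: `L_r = {ℓ, r}^⊥` is `≅ 2U ⊕ mE₈(−1)` if `2d ∣ (r, ℓ^⊥)`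
  (`restrict_orthogonal_span_pair_equivalent_of_two_mul_dvd_rank`), and otherwise
  `≅ U ⊕ mE₈(−1) ⊕ ⟨2⟩ ⊕ ⟨−2⟩` or `≅ U ⊕ U(2) ⊕ mE₈(−1)` (`…_or_of_not_two_mul_dvd_rank`), the alternative being
  `δ(L_r) = 1` resp. `δ(L_r) = 0` (`…_of_deltaInvariant_rank`). As in [GHS2] the proof computes the invariants
  `(rk, sign, ℓ, δ)` of the even `2`-elementary lattice `L_r`
  (`invariants_restrict_orthogonal_span_pair_of_neg_vector_rank`, from the tree's arbitrary-rank lemmas),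
  identifies the discriminant form by Nikulin's Thm. 3.6.2 (`IsTwoElementary.exists_isometry_of_invariants_eq`)
  and concludes by uniqueness in the genus (Nikulin Cor. 1.13.3). Deviation from the tree's `m = 2` proof:
  uniqueness is invoked in the form `equivalent_of_discriminantQuad_iso_of_hyperbolicPair` (each model visibly
  splits off `U`) instead of the criterion `rk ≥ ℓ + 3`, so that the case `m = 0` (`rk L_r = 4 = ℓ(L_r) + 2` when
  `div(r) = d`) is covered, as printed.
* §2 plumbing: `r^⊥` taken inside the lattice `ℓ^⊥` is `{ℓ, r}^⊥ ⊂ Λ`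
  (`restrict_restrict_orthogonal_span_singleton_equivalent`), and primitivity inside `ℓ^⊥` is primitivity in `Λ`
  (`forall_mem_span_singleton_coe_of_orthogonal`).
* §3 transport along any identification `e : ℓ^⊥ ≅ L` (`transport_of_isometryEquiv_restrict_orthogonal`): the three
  results for `r ∈ L` primitive with `r² = −2d`, all hypotheses stated on `L`
  (`restrict_orthogonal_equivalent_of_isometryEquiv_restrict_orthogonal_of_two_mul_dvd`,
  `restrict_orthogonal_equivalent_or_of_isometryEquiv_restrict_orthogonal_of_not_two_mul_dvd`,
  `restrict_orthogonal_equivalent_of_isometryEquiv_restrict_orthogonal_of_deltaInvariant`).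
* §4 the standalone model of the tree, `L_{2d}^{(m)} = (mE₈(−1) ⊕ 2U) ⊕ ⟨−2d⟩`
  (`((pi fun _ : Fin m ↦ -e8Form).prod (hyperbolicSum 2)).prod ((-(2d)) • mul)`, the lattice of
  `LatticeFormsNegTwoVectorOrbits` / `LatticeFormsNegTwoDVectorOrbitCount`), realised as `h^⊥` for
  `h = e₁ + d f₁ ∈ mE₈(−1) ⊕ 3U` (`restrict_orthogonal_pi_neg_e8Form_prod_hyperbolicSum_three_equivalent_latticeL2dm`,
  by the tree's Example 1.11 (i) mechanism `restrict_orthogonal_equivalent_of_equivalent_prod_hyperbolicForm`), and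
  Prop. 2.4 (iii) verbatim for it: `restrict_orthogonal_latticeL2dm_equivalent_neg_twoMul_of_divisor_twoMul`
  (`div(r) = 2d ⟹ r^⊥ ≅ 2U ⊕ mE₈(−1)`), `restrict_orthogonal_latticeL2dm_equivalent_or_neg_twoMul_of_divisor`
  (`div(r) = d ⟹ r^⊥ ≅ K_2^{(m)}` or `T_{2,8m+2}`), `restrict_orthogonal_latticeL2dm_equivalent_neg_twoMul_of_deltaInvariant`
  (which one, by `δ(r^⊥)`).

## Reading notes

* `div(r)`, the positive generator of the ideal `(r, L)`, is rendered by divisibility hypotheses: "`div(r) = 2d`" is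
  `∀ z, 2d ∣ (r, z)` (then `div(r) = 2d` exactly, as `div(r) ∣ r² = −2d`), and "`div(r) = d`" is `∀ z, d ∣ (r, z)`
  together with `¬ ∀ z, 2d ∣ (r, z)`; for a primitive `(−2d)`-vector of `L_{2d}^{(m)}` these are the only
  possibilities ([GHS2]: "then `div(r) = d` or `2d`"; in the tree: `dvd_two_mul_of_forall_dvd_of_primitive`).
  `r` is assumed primitive (`hsat`), as in [GHS2, Prop. 4.6].
* Lattices are compared up to isometry (`LinearMap.BilinForm.Equivalent`); `K_2^{(m)}` is written
  `(mE₈(−1) ⊕ U) ⊕ (⟨2⟩ ⊕ ⟨−2⟩)` and `T_{2,8m+2}` as `(mE₈(−1) ⊕ U) ⊕ U(2)` with `U(2) = 2 • hyperbolicSum 1`, the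
  normal forms of `LatticeFormsTwoElementaryInvariants` used by the tree's `m = 2` theorems.
* Which of `K_2^{(m)}`, `T_{2,8m+2}` occurs is decided by `δ(r^⊥)`; the source states the dichotomy, and so do we
  (plus the `δ`-criterion of [GHS2]'s proof).

## References

* [GritsenkoHulekSankaran2008Proportionality] V. Gritsenko, K. Hulek, G. K. Sankaran, *Hirzebruch–Mumford
  proportionality and locally symmetric varieties of orthogonal type*, Doc. Math. 13 (2008) 1–19,
  doi:10.4171/dm/239, arXiv:math/0609774 — Prop. 2.4 (iii) and proof.
* [GritsenkoHulekSankaran2007Kodaira] V. Gritsenko, K. Hulek, G. K. Sankaran, *The Kodaira dimension of the moduli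
  of K3 surfaces*, Invent. Math. 169 (2007) 519–567, arXiv:math/0607339 — §4 (arXiv numbering) Prop. 4.6 and proof.
* [Nikulin1980] V. V. Nikulin, *Integral symmetric bilinear forms and some of their applications*, Math. USSR Izv.
  14 (1980) 103–167 — Cor. 1.13.3, Thm. 3.6.2.
* [Huybrechts2016K3] D. Huybrechts, *Lectures on K3 surfaces*, CUP 2016 — Ch. 14 §0, Ex. 1.11 (i).
-/

noncomputable section

open Module Function
open LinearMap (BilinForm)
open LinearMap.BilinForm

namespace Literature.Topology.FourManifolds

universe u

variable {M : Type u} [AddCommGroup M] [Module.Free ℤ M] [Module.Finite ℤ M] (B : BilinForm ℤ M)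

/-! ### §0 A hyperbolic pair in `R ⊕ U^{n+1} ⊕ T` -/

/-- The standard hyperbolic pair `e₁, f₁` of the middle summand of `R ⊕ U^{n+1} ⊕ T`: `e₁² = 0`, `e₁·f₁ = 1`,
`f₁² = 0`. [cite: Huybrechts2016K3, Ch. 14 §0.3 (ii)] -/
theorem hyperbolicPair_prod_hyperbolicSum_succ_prod {P : Type*} [AddCommGroup P] (R : BilinForm ℤ P) (n : ℕ)
    {N : Type*} [AddCommGroup N] (T : BilinForm ℤ N) :
    ((R.prod (hyperbolicSum (n + 1))).prod T) ((0, (Pi.single 0 1, 0)), 0) ((0, (Pi.single 0 1, 0)), 0) = 0 ∧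
    ((R.prod (hyperbolicSum (n + 1))).prod T) ((0, (Pi.single 0 1, 0)), 0) ((0, (0, Pi.single 0 1)), 0) = 1 ∧
    ((R.prod (hyperbolicSum (n + 1))).prod T) ((0, (0, Pi.single 0 1)), 0) ((0, (0, Pi.single 0 1)), 0) = 0 := by
  simp [LinearMap.BilinForm.prod_apply]

/-! ### §1 "For general `m` the proof is the same": `Λ` even unimodular of rank `8m + 6`, signature `−8m` -/

section GeneralRank

variable (m : ℕ)

/-- **The invariants of `L_r`, general rank.** For an even unimodular `Λ` of rank `8m + 6` and signature `−8m`
(`II_{3,8m+3} = 3U ⊕ mE₈(−1)`), `ℓ` primitive with `ℓ² = 2d > 0`, `r ⊥ ℓ` primitive with `r² = −2d` and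
`d ∣ (r, ℓ^⊥)`: `L_r = {ℓ, r}^⊥` is nondegenerate, even, `2`-elementary, of rank `8m + 4`, signature `−8m`, with
`ℓ(L_r) ∈ {0, 2}` and `ℓ(L_r) = 0 ⟺ div(r) = 2d`. [cite: GritsenkoHulekSankaran2008Proportionality, Prop. 2.4 (iii) and proof ("This was proved in [GHS2] for `m = 2`. For general `m` the proof is the same.")] [cite: GritsenkoHulekSankaran2007Kodaira, §4 (arXiv numbering) proof of Prop. 4.6] -/
theorem invariants_restrict_orthogonal_span_pair_of_neg_vector_rank (hs : B.IsSymm) (he : B.IsEven)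
    (hu : B.IsUnimodular) (hrk : finrank ℤ M = 8 * m + 6) (hσ : B.signature = -(8 * m : ℤ)) {ℓ r : M} {d : ℤ}
    (hd : 0 < d) (hℓ : B ℓ ℓ = 2 * d) (hℓsat : ∀ (k : ℤ) (w : M), k ≠ 0 → k • w ∈ ℤ ∙ ℓ → w ∈ ℤ ∙ ℓ)
    (hrℓ : B r ℓ = 0) (hr : B r r = -(2 * d)) (hrsat : ∀ (k : ℤ) (w : M), k ≠ 0 → k • w ∈ ℤ ∙ r → w ∈ ℤ ∙ r)
    (hdvd : ∀ w, B w ℓ = 0 → d ∣ B r w) :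
    (B.restrict (B.orthogonal (Submodule.span ℤ {ℓ, r}))).Nondegenerate ∧
    (B.restrict (B.orthogonal (Submodule.span ℤ {ℓ, r}))).IsSymm ∧
    (B.restrict (B.orthogonal (Submodule.span ℤ {ℓ, r}))).IsEven ∧
    (B.restrict (B.orthogonal (Submodule.span ℤ {ℓ, r}))).IsTwoElementary ∧
    finrank ℤ (B.orthogonal (Submodule.span ℤ {ℓ, r})) = 8 * m + 4 ∧
    (B.restrict (B.orthogonal (Submodule.span ℤ {ℓ, r}))).signature = -(8 * m : ℤ) ∧
    ((B.restrict (B.orthogonal (Submodule.span ℤ {ℓ, r}))).length = 0 ∨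
      (B.restrict (B.orthogonal (Submodule.span ℤ {ℓ, r}))).length = 2) ∧
    ((B.restrict (B.orthogonal (Submodule.span ℤ {ℓ, r}))).length = 0 ↔ ∀ w, B w ℓ = 0 → 2 * d ∣ B r w) := by
  have hnd := nondegenerate_restrict_orthogonal_span_pair_of_neg_vector B hs he hu hd hℓ hℓsat hrℓ hr hrsat hdvd
  have h2 := isTwoElementary_restrict_orthogonal_span_pair_of_neg_vector B hs he hu hd hℓ hℓsat hrℓ hr hrsat hdvd
  have hrk' := finrank_orthogonal_span_pair_add_two B hs hd.ne' hℓ hrℓ hr hnd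
  have hle := length_restrict_orthogonal_span_pair_le_two B hs he hu hd.ne' hℓ hrℓ hr hnd
  have hne := length_restrict_orthogonal_span_pair_ne_one B hs he hu hd hℓ hrℓ hr hnd h2
  refine ⟨hnd, hs.restrict _, isEven_restrict he _, h2, by omega,
    (signature_restrict_orthogonal_span_pair B hs hu hd hℓ hrℓ hr hnd).trans hσ, by omega,
    length_restrict_orthogonal_span_pair_eq_zero_iff B hs he hu hd hℓ hℓsat hrℓ hr hrsat hdvd⟩

/-- **`div(r) = 2d`: `L_r ≅ 2U ⊕ mE₈(−1) = II_{2,8m+2}`** (general rank; `m = 2` is the tree's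
`restrict_orthogonal_span_pair_equivalent_of_two_mul_dvd`). [cite: GritsenkoHulekSankaran2008Proportionality, Prop. 2.4 (iii) ("isometric to `II_{2,8m+2} = 2U ⊕ mE₈(−1)` if `div(r) = 2d`")] [cite: GritsenkoHulekSankaran2007Kodaira, §4 (arXiv numbering) Prop. 4.6] [cite: Nikulin1980, Cor. 1.13.3, Thm. 3.6.2] -/
theorem restrict_orthogonal_span_pair_equivalent_of_two_mul_dvd_rank (hs : B.IsSymm) (he : B.IsEven)
    (hu : B.IsUnimodular) (hrk : finrank ℤ M = 8 * m + 6) (hσ : B.signature = -(8 * m : ℤ)) {ℓ r : M} {d : ℤ}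
    (hd : 0 < d) (hℓ : B ℓ ℓ = 2 * d) (hℓsat : ∀ (k : ℤ) (w : M), k ≠ 0 → k • w ∈ ℤ ∙ ℓ → w ∈ ℤ ∙ ℓ)
    (hrℓ : B r ℓ = 0) (hr : B r r = -(2 * d)) (hrsat : ∀ (k : ℤ) (w : M), k ≠ 0 → k • w ∈ ℤ ∙ r → w ∈ ℤ ∙ r)
    (h2d : ∀ w, B w ℓ = 0 → 2 * d ∣ B r w) :
    (B.restrict (B.orthogonal (Submodule.span ℤ {ℓ, r}))).Equivalent
      ((pi fun _ : Fin m ↦ -e8Form).prod (hyperbolicSum 2)) := by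
  have hdvd : ∀ w, B w ℓ = 0 → d ∣ B r w := fun w hw ↦ (dvd_mul_left d 2).trans (h2d w hw)
  obtain ⟨hKn, hKs, hKe, hK2, hKrk, hKσ, -, hKℓ⟩ :=
    invariants_restrict_orthogonal_span_pair_of_neg_vector_rank B m hs he hu hrk hσ hd hℓ hℓsat hrℓ hr hrsat hdvd
  have hKℓ0 := hKℓ.2 h2d
  have hKu := (length_eq_zero_iff_isUnimodular _ hKn).1 hKℓ0
  have hKδ := deltaInvariant_eq_zero_of_isUnimodular _ hKn hKs hKe hKu
  obtain ⟨hMs, hMe, hMu, hMσ⟩ := pi_neg_e8Form_prod_hyperbolicSum_invariants m 2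
  have hMn := hMu.nondegenerate
  obtain ⟨hMrk, hM2, hMℓ, hMδ, -⟩ := invariants_pi_neg_e8Form_prod_hyperbolicSum m 2 hMn hMs hMe
  obtain ⟨φ, -, hφq⟩ := hK2.exists_isometry_of_invariants_eq _ _ hM2 hKn hKs hKe hMn hMs hMe (by rw [hKℓ0, hMℓ])
    (by rw [hKδ, hMδ]) (by rw [hKσ, hMσ, sub_self]; exact dvd_zero _)
  have hP := twoHyperbolicPairs_pi_neg_e8Form_prod_hyperbolicSum_two m
  exact equivalent_of_discriminantQuad_iso_of_hyperbolicPair _ _ hKn hKs hKe hMn hMs hMe (by rw [hKrk, hMrk])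
    (by rw [hKσ, hMσ]) φ hφq hP.xx hP.xy hP.yy

/-- **`div(r) = d`: `L_r ≅ U ⊕ mE₈(−1) ⊕ ⟨2⟩ ⊕ ⟨−2⟩ = K_2^{(m)}` or `≅ U ⊕ U(2) ⊕ mE₈(−1) = T_{2,8m+2}`** (general
rank; `m = 2` is the tree's `restrict_orthogonal_span_pair_equivalent_or_of_not_two_mul_dvd`).
[cite: GritsenkoHulekSankaran2008Proportionality, Prop. 2.4 (iii) ("and to `K_2^{(m)} = U ⊕ mE₈(−1) ⊕ ⟨2⟩ ⊕ ⟨−2⟩` or `T_{2,8m+2} = U ⊕ U(2) ⊕ mE₈(−1)` if `div(r) = d`")] [cite: GritsenkoHulekSankaran2007Kodaira, §4 (arXiv numbering) Prop. 4.6] [cite: Nikulin1980, Cor. 1.13.3, Thm. 3.6.2] -/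
theorem restrict_orthogonal_span_pair_equivalent_or_of_not_two_mul_dvd_rank (hs : B.IsSymm) (he : B.IsEven)
    (hu : B.IsUnimodular) (hrk : finrank ℤ M = 8 * m + 6) (hσ : B.signature = -(8 * m : ℤ)) {ℓ r : M} {d : ℤ}
    (hd : 0 < d) (hℓ : B ℓ ℓ = 2 * d) (hℓsat : ∀ (k : ℤ) (w : M), k ≠ 0 → k • w ∈ ℤ ∙ ℓ → w ∈ ℤ ∙ ℓ)
    (hrℓ : B r ℓ = 0) (hr : B r r = -(2 * d)) (hrsat : ∀ (k : ℤ) (w : M), k ≠ 0 → k • w ∈ ℤ ∙ r → w ∈ ℤ ∙ r)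
    (hdvd : ∀ w, B w ℓ = 0 → d ∣ B r w) (hndvd : ¬ ∀ w, B w ℓ = 0 → 2 * d ∣ B r w) :
    (B.restrict (B.orthogonal (Submodule.span ℤ {ℓ, r}))).Equivalent
        (((pi fun _ : Fin m ↦ -e8Form).prod (hyperbolicSum 1)).prod
          (BilinForm.prod ((2 : ℤ) • ((1 : ℤ) • LinearMap.mul ℤ ℤ)) ((2 : ℤ) • ((-1 : ℤ) • LinearMap.mul ℤ ℤ)))) ∨
      (B.restrict (B.orthogonal (Submodule.span ℤ {ℓ, r}))).Equivalent
        (((pi fun _ : Fin m ↦ -e8Form).prod (hyperbolicSum 1)).prod ((2 : ℤ) • hyperbolicSum 1)) := by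
  obtain ⟨hKn, hKs, hKe, hK2, hKrk, hKσ, hKℓ02, hKℓ⟩ :=
    invariants_restrict_orthogonal_span_pair_of_neg_vector_rank B m hs he hu hrk hσ hd hℓ hℓsat hrℓ hr hrsat hdvd
  have hKℓ2 : (B.restrict (B.orthogonal (Submodule.span ℤ {ℓ, r}))).length = 2 := by
    rcases hKℓ02 with h | h
    · exact absurd (hKℓ.1 h) hndvd
    · exact h
  rcases (B.restrict (B.orthogonal (Submodule.span ℤ {ℓ, r}))).deltaInvariant_eq_zero_or_eq_one hKn hKs hKe
    with hKδ | hKδ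
  · right
    obtain ⟨hMs, hMe, hMn, hM2, hMℓ, hMσ, hMrk, hMδ⟩ :=
      invariants_pi_neg_e8Form_prod_hyperbolicSum_prod_two_smul_hyperbolicSum m 1
    obtain ⟨φ, -, hφq⟩ := hK2.exists_isometry_of_invariants_eq _ _ hM2 hKn hKs hKe hMn hMs hMe (by rw [hKℓ2, hMℓ])
      (by rw [hKδ, hMδ hMn hMs hMe]) (by rw [hKσ, hMσ, sub_self]; exact dvd_zero _)
    obtain ⟨hx, hxy, hy⟩ := hyperbolicPair_prod_hyperbolicSum_succ_prod (pi fun _ : Fin m ↦ -e8Form) 0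
      ((2 : ℤ) • hyperbolicSum 1)
    exact equivalent_of_discriminantQuad_iso_of_hyperbolicPair _ _ hKn hKs hKe hMn hMs hMe (by rw [hKrk, hMrk])
      (by rw [hKσ, hMσ]) φ hφq hx hxy hy
  · left
    obtain ⟨hMs, hMe, hMn, hM2, hMℓ, hMσ, hMrk, hMδ⟩ := invariants_pi_neg_e8Form_prod_hyperbolicSum_prod_two_negTwo m 1
    obtain ⟨φ, -, hφq⟩ := hK2.exists_isometry_of_invariants_eq _ _ hM2 hKn hKs hKe hMn hMs hMe (by rw [hKℓ2, hMℓ])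
      (by rw [hKδ, hMδ hMn hMs hMe]) (by rw [hKσ, hMσ, sub_self]; exact dvd_zero _)
    obtain ⟨hx, hxy, hy⟩ := hyperbolicPair_prod_hyperbolicSum_succ_prod (pi fun _ : Fin m ↦ -e8Form) 0
      (BilinForm.prod ((2 : ℤ) • ((1 : ℤ) • LinearMap.mul ℤ ℤ)) ((2 : ℤ) • ((-1 : ℤ) • LinearMap.mul ℤ ℤ)))
    exact equivalent_of_discriminantQuad_iso_of_hyperbolicPair _ _ hKn hKs hKe hMn hMs hMe (by rw [hKrk, hMrk])
      (by rw [hKσ, hMσ]) φ hφq hx hxy hy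

/-- **The two alternatives for `div(r) = d` are told apart by `δ(L_r)`** (general rank; `m = 2` is the tree's
`restrict_orthogonal_span_pair_equivalent_of_deltaInvariant`): `δ(L_r) = 1 ⟹ L_r ≅ U ⊕ mE₈(−1) ⊕ ⟨2⟩ ⊕ ⟨−2⟩`,
`δ(L_r) = 0 ⟹ L_r ≅ U ⊕ U(2) ⊕ mE₈(−1)`. [cite: GritsenkoHulekSankaran2007Kodaira, §4 (arXiv numbering) proof of Prop. 4.6 ("`S_r ≅ U(2)` if `δ_{S_r} = 0`, `⟨2⟩ ⊕ ⟨−2⟩` if `δ_{S_r} = 1`")] [cite: GritsenkoHulekSankaran2008Proportionality, Prop. 2.4 (iii)] [cite: Nikulin1980, Cor. 1.13.3, Thm. 3.6.2] -/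
theorem restrict_orthogonal_span_pair_equivalent_of_deltaInvariant_rank (hs : B.IsSymm) (he : B.IsEven)
    (hu : B.IsUnimodular) (hrk : finrank ℤ M = 8 * m + 6) (hσ : B.signature = -(8 * m : ℤ)) {ℓ r : M} {d : ℤ}
    (hd : 0 < d) (hℓ : B ℓ ℓ = 2 * d) (hℓsat : ∀ (k : ℤ) (w : M), k ≠ 0 → k • w ∈ ℤ ∙ ℓ → w ∈ ℤ ∙ ℓ)
    (hrℓ : B r ℓ = 0) (hr : B r r = -(2 * d)) (hrsat : ∀ (k : ℤ) (w : M), k ≠ 0 → k • w ∈ ℤ ∙ r → w ∈ ℤ ∙ r)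
    (hdvd : ∀ w, B w ℓ = 0 → d ∣ B r w) (hndvd : ¬ ∀ w, B w ℓ = 0 → 2 * d ∣ B r w) :
    (∀ h₁ h₂ h₃, (B.restrict (B.orthogonal (Submodule.span ℤ {ℓ, r}))).deltaInvariant h₁ h₂ h₃ = 1 →
      (B.restrict (B.orthogonal (Submodule.span ℤ {ℓ, r}))).Equivalent
        (((pi fun _ : Fin m ↦ -e8Form).prod (hyperbolicSum 1)).prod
          (BilinForm.prod ((2 : ℤ) • ((1 : ℤ) • LinearMap.mul ℤ ℤ)) ((2 : ℤ) • ((-1 : ℤ) • LinearMap.mul ℤ ℤ))))) ∧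
    (∀ h₁ h₂ h₃, (B.restrict (B.orthogonal (Submodule.span ℤ {ℓ, r}))).deltaInvariant h₁ h₂ h₃ = 0 →
      (B.restrict (B.orthogonal (Submodule.span ℤ {ℓ, r}))).Equivalent
        (((pi fun _ : Fin m ↦ -e8Form).prod (hyperbolicSum 1)).prod ((2 : ℤ) • hyperbolicSum 1))) := by
  obtain ⟨hKn, hKs, hKe, hK2, hKrk, hKσ, hKℓ02, hKℓ⟩ :=
    invariants_restrict_orthogonal_span_pair_of_neg_vector_rank B m hs he hu hrk hσ hd hℓ hℓsat hrℓ hr hrsat hdvd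
  have hKℓ2 : (B.restrict (B.orthogonal (Submodule.span ℤ {ℓ, r}))).length = 2 := by
    rcases hKℓ02 with h | h
    · exact absurd (hKℓ.1 h) hndvd
    · exact h
  constructor
  · intro h₁ h₂ h₃ hKδ
    obtain ⟨hMs, hMe, hMn, hM2, hMℓ, hMσ, hMrk, hMδ⟩ := invariants_pi_neg_e8Form_prod_hyperbolicSum_prod_two_negTwo m 1
    obtain ⟨φ, -, hφq⟩ := hK2.exists_isometry_of_invariants_eq _ _ hM2 h₁ h₂ h₃ hMn hMs hMe (by rw [hKℓ2, hMℓ])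
      (by rw [hKδ, hMδ hMn hMs hMe]) (by rw [hKσ, hMσ, sub_self]; exact dvd_zero _)
    obtain ⟨hx, hxy, hy⟩ := hyperbolicPair_prod_hyperbolicSum_succ_prod (pi fun _ : Fin m ↦ -e8Form) 0
      (BilinForm.prod ((2 : ℤ) • ((1 : ℤ) • LinearMap.mul ℤ ℤ)) ((2 : ℤ) • ((-1 : ℤ) • LinearMap.mul ℤ ℤ)))
    exact equivalent_of_discriminantQuad_iso_of_hyperbolicPair _ _ h₁ h₂ h₃ hMn hMs hMe (by rw [hKrk, hMrk])
      (by rw [hKσ, hMσ]) φ hφq hx hxy hy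
  · intro h₁ h₂ h₃ hKδ
    obtain ⟨hMs, hMe, hMn, hM2, hMℓ, hMσ, hMrk, hMδ⟩ :=
      invariants_pi_neg_e8Form_prod_hyperbolicSum_prod_two_smul_hyperbolicSum m 1
    obtain ⟨φ, -, hφq⟩ := hK2.exists_isometry_of_invariants_eq _ _ hM2 h₁ h₂ h₃ hMn hMs hMe (by rw [hKℓ2, hMℓ])
      (by rw [hKδ, hMδ hMn hMs hMe]) (by rw [hKσ, hMσ, sub_self]; exact dvd_zero _)
    obtain ⟨hx, hxy, hy⟩ := hyperbolicPair_prod_hyperbolicSum_succ_prod (pi fun _ : Fin m ↦ -e8Form) 0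
      ((2 : ℤ) • hyperbolicSum 1)
    exact equivalent_of_discriminantQuad_iso_of_hyperbolicPair _ _ h₁ h₂ h₃ hMn hMs hMe (by rw [hKrk, hMrk])
      (by rw [hKσ, hMσ]) φ hφq hx hxy hy

end GeneralRank

/-! ### §2 `r^⊥` inside `ℓ^⊥` is `{ℓ, r}^⊥`; primitivity inside `ℓ^⊥` -/

section Plumbing

omit [Module.Free ℤ M] [Module.Finite ℤ M] in
/-- **`r^⊥_{ℓ^⊥} = {ℓ, r}^⊥`** as bilinear modules: for `r ∈ ℓ^⊥`, the orthogonal complement of `r` inside the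
lattice `ℓ^⊥` (with the restricted form) is isometric to `{ℓ, r}^⊥ ⊂ Λ` (GHS's "`L_r = r^⊥_{L_{2d}}`" with
`L_{2d} = h^⊥`). [cite: GritsenkoHulekSankaran2007Kodaira, §4 (arXiv numbering) proof of Prop. 4.6 ("We put `L_r = r^⊥_{L_{2d}}`")] -/
theorem restrict_restrict_orthogonal_span_singleton_equivalent {ℓ : M} (r : B.orthogonal (ℤ ∙ ℓ)) :
    ((B.restrict (B.orthogonal (ℤ ∙ ℓ))).restrict
        ((B.restrict (B.orthogonal (ℤ ∙ ℓ))).orthogonal (ℤ ∙ r))).Equivalent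
      (B.restrict (B.orthogonal (Submodule.span ℤ {ℓ, (r : M)}))) := by
  have key₁ : ∀ x : B.orthogonal (ℤ ∙ ℓ), x ∈ (B.restrict (B.orthogonal (ℤ ∙ ℓ))).orthogonal (ℤ ∙ r) ↔
      B (r : M) (x : M) = 0 := fun x ↦ by
    rw [(B.restrict (B.orthogonal (ℤ ∙ ℓ))).mem_orthogonal_span_singleton_iff]
    rfl
  have key₂ : ∀ y : M, y ∈ B.orthogonal (Submodule.span ℤ {ℓ, (r : M)}) ↔ B ℓ y = 0 ∧ B (r : M) y = 0 :=
    fun y ↦ B.mem_orthogonal_span_pair_iff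
  have key₃ : ∀ y : M, y ∈ B.orthogonal (ℤ ∙ ℓ) ↔ B ℓ y = 0 := fun y ↦ B.mem_orthogonal_span_singleton_iff
  exact ⟨{ toFun := fun x ↦ ⟨(x.1 : M), (key₂ _).2 ⟨(key₃ _).1 x.1.2, (key₁ _).1 x.2⟩⟩
           invFun := fun y ↦ ⟨⟨(y : M), (key₃ _).2 ((key₂ _).1 y.2).1⟩, (key₁ _).2 ((key₂ _).1 y.2).2⟩
           map_add' := fun _ _ ↦ rfl
           map_smul' := fun _ _ ↦ rfl
           left_inv := fun _ ↦ rfl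
           right_inv := fun _ ↦ rfl
           map_app' := fun _ _ ↦ rfl }⟩

omit [Module.Free ℤ M] [Module.Finite ℤ M] in
/-- `ℓ^⊥` is saturated in a torsion-free lattice: `k y ⊥ ℓ`, `k ≠ 0` ⟹ `y ⊥ ℓ`. [cite: Huybrechts2016K3, Ch. 14 §0.1 (primitive sublattices)] -/
theorem mem_orthogonal_span_singleton_of_smul_mem [Module.IsTorsionFree ℤ M] {ℓ y : M} {k : ℤ} (hk : k ≠ 0)
    (h : k • y ∈ B.orthogonal (ℤ ∙ ℓ)) : y ∈ B.orthogonal (ℤ ∙ ℓ) := by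
  rw [B.mem_orthogonal_span_singleton_iff] at h ⊢
  rw [map_zsmul, smul_eq_mul] at h
  exact (mul_eq_zero.1 h).resolve_left hk

omit [Module.Free ℤ M] [Module.Finite ℤ M] in
/-- **Primitive in `ℓ^⊥` ⟹ primitive in `Λ`**: if `ℤr` is saturated in the lattice `ℓ^⊥`, it is saturated in `Λ`
(`ℓ^⊥` itself being saturated). [cite: GritsenkoHulekSankaran2007Kodaira, §4 (arXiv numbering) Prop. 4.6 ("Let `r` be a primitive vector of `L_{2d}`")] [cite: Huybrechts2016K3, Ch. 14 §0.1] -/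
theorem forall_mem_span_singleton_coe_of_orthogonal [Module.IsTorsionFree ℤ M] {ℓ : M}
    {r : B.orthogonal (ℤ ∙ ℓ)}
    (hsat : ∀ (k : ℤ) (w : B.orthogonal (ℤ ∙ ℓ)), k ≠ 0 → k • w ∈ ℤ ∙ r → w ∈ ℤ ∙ r) :
    ∀ (k : ℤ) (y : M), k ≠ 0 → k • y ∈ ℤ ∙ (r : M) → y ∈ ℤ ∙ (r : M) := by
  intro k y hk hy
  obtain ⟨a, ha⟩ := Submodule.mem_span_singleton.1 hy
  have hky : k • y ∈ B.orthogonal (ℤ ∙ ℓ) := by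
    rw [← ha]
    exact Submodule.smul_mem _ _ r.2
  have hy' : y ∈ B.orthogonal (ℤ ∙ ℓ) := mem_orthogonal_span_singleton_of_smul_mem B hk hky
  have h1 : k • (⟨y, hy'⟩ : B.orthogonal (ℤ ∙ ℓ)) ∈ ℤ ∙ r :=
    Submodule.mem_span_singleton.2 ⟨a, Subtype.ext (by simpa using ha)⟩
  obtain ⟨c, hc⟩ := Submodule.mem_span_singleton.1 (hsat k _ hk h1)
  exact Submodule.mem_span_singleton.2 ⟨c, by simpa using congrArg Subtype.val hc⟩

end Plumbing

/-! ### §3 `L_{2d} = ℓ^⊥` identified with any lattice `L`: the complement of a `(−2d)`-vector of `L` -/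

section Transport

variable (m : ℕ) {N : Type*} [AddCommGroup N] {L : BilinForm ℤ N}

/-- Transport of the hypotheses of Prop. 4.6 along an identification `e : ℓ^⊥ ≅ L`: for `r ∈ L`, the vector
`r' = e⁻¹ r ∈ ℓ^⊥ ⊂ Λ` has `r' ⊥ ℓ`, `r'² = r²`, is primitive in `Λ` when `r` is primitive in `L`, and
`n ∣ (r', w)` for all `w ⊥ ℓ` iff `n ∣ (r, z)` for all `z ∈ L`; and `r^⊥_L ≅ {ℓ, r'}^⊥_Λ`.
[cite: GritsenkoHulekSankaran2007Kodaira, §4 (arXiv numbering) proof of Prop. 4.6 ("`L_r = r^⊥_{L_{2d}}`")] -/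
theorem transport_of_isometryEquiv_restrict_orthogonal (hs : B.IsSymm) {ℓ : M}
    (e : (B.restrict (B.orthogonal (ℤ ∙ ℓ))).IsometryEquiv L) (r : N) :
    B (e.symm r : M) ℓ = 0 ∧ B (e.symm r : M) (e.symm r : M) = L r r ∧
    ((∀ (k : ℤ) (w : N), k ≠ 0 → k • w ∈ ℤ ∙ r → w ∈ ℤ ∙ r) →
      ∀ (k : ℤ) (y : M), k ≠ 0 → k • y ∈ ℤ ∙ (e.symm r : M) → y ∈ ℤ ∙ (e.symm r : M)) ∧
    (∀ n : ℤ, (∀ w, B w ℓ = 0 → n ∣ B (e.symm r : M) w) ↔ ∀ z, n ∣ L r z) ∧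
    (L.restrict (L.orthogonal (ℤ ∙ r))).Equivalent
      (B.restrict (B.orthogonal (Submodule.span ℤ {ℓ, (e.symm r : M)}))) := by
  have hW : ∀ w : M, w ∈ B.orthogonal (ℤ ∙ ℓ) ↔ B w ℓ = 0 := fun w ↦ by
    rw [B.mem_orthogonal_span_singleton_iff, hs.eq]
  refine ⟨(hW _).1 (e.symm r).2, ?_, fun hrsat ↦ forall_mem_span_singleton_coe_of_orthogonal B
    (forall_mem_span_singleton_apply_of_isometryEquiv e.symm hrsat), fun n ↦ ?_,
    (restrict_orthogonal_equivalent_of_isometryEquiv e.symm r).trans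
      (restrict_restrict_orthogonal_span_singleton_equivalent B (e.symm r))⟩
  · rw [← e.symm.map_app r r]
    rfl
  · rw [← forall_dvd_apply_iff_of_isometryEquiv e.symm r n]
    exact ⟨fun h z ↦ h (z : M) ((hW _).1 z.2), fun h w hw ↦ h ⟨w, (hW _).2 hw⟩⟩

/-- **`div(r) = 2d ⟹ r^⊥_L ≅ 2U ⊕ mE₈(−1)`**, for `L ≅ ℓ^⊥` the complement of a primitive `2d`-vector `ℓ` of an even
unimodular lattice of rank `8m + 6` and signature `−8m`, and `r ∈ L` primitive with `r² = −2d`.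
[cite: GritsenkoHulekSankaran2008Proportionality, Prop. 2.4 (iii)] [cite: GritsenkoHulekSankaran2007Kodaira, §4 (arXiv numbering) Prop. 4.6] -/
theorem restrict_orthogonal_equivalent_of_isometryEquiv_restrict_orthogonal_of_two_mul_dvd (hs : B.IsSymm)
    (he : B.IsEven) (hu : B.IsUnimodular) (hrk : finrank ℤ M = 8 * m + 6) (hσ : B.signature = -(8 * m : ℤ))
    {ℓ : M} {d : ℤ} (hd : 0 < d) (hℓ : B ℓ ℓ = 2 * d)
    (hℓsat : ∀ (k : ℤ) (w : M), k ≠ 0 → k • w ∈ ℤ ∙ ℓ → w ∈ ℤ ∙ ℓ)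
    (e : (B.restrict (B.orthogonal (ℤ ∙ ℓ))).IsometryEquiv L) {r : N} (hr : L r r = -(2 * d))
    (hrsat : ∀ (k : ℤ) (w : N), k ≠ 0 → k • w ∈ ℤ ∙ r → w ∈ ℤ ∙ r) (h2d : ∀ z, 2 * d ∣ L r z) :
    (L.restrict (L.orthogonal (ℤ ∙ r))).Equivalent ((pi fun _ : Fin m ↦ -e8Form).prod (hyperbolicSum 2)) := by
  obtain ⟨hrℓ, hr', hrsat', hdvd', E⟩ := transport_of_isometryEquiv_restrict_orthogonal B hs e r
  exact E.trans (restrict_orthogonal_span_pair_equivalent_of_two_mul_dvd_rank B m hs he hu hrk hσ hd hℓ hℓsat hrℓ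
    (hr'.trans hr) (hrsat' hrsat) ((hdvd' _).2 h2d))

/-- **`div(r) = d ⟹ r^⊥_L ≅ U ⊕ mE₈(−1) ⊕ ⟨2⟩ ⊕ ⟨−2⟩` or `U ⊕ U(2) ⊕ mE₈(−1)`**, for `L ≅ ℓ^⊥` as above and
`r ∈ L` primitive with `r² = −2d`, `d ∣ (r, L)`, `div(r) ≠ 2d`.
[cite: GritsenkoHulekSankaran2008Proportionality, Prop. 2.4 (iii)] [cite: GritsenkoHulekSankaran2007Kodaira, §4 (arXiv numbering) Prop. 4.6] -/
theorem restrict_orthogonal_equivalent_or_of_isometryEquiv_restrict_orthogonal_of_not_two_mul_dvd (hs : B.IsSymm)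
    (he : B.IsEven) (hu : B.IsUnimodular) (hrk : finrank ℤ M = 8 * m + 6) (hσ : B.signature = -(8 * m : ℤ))
    {ℓ : M} {d : ℤ} (hd : 0 < d) (hℓ : B ℓ ℓ = 2 * d)
    (hℓsat : ∀ (k : ℤ) (w : M), k ≠ 0 → k • w ∈ ℤ ∙ ℓ → w ∈ ℤ ∙ ℓ)
    (e : (B.restrict (B.orthogonal (ℤ ∙ ℓ))).IsometryEquiv L) {r : N} (hr : L r r = -(2 * d))
    (hrsat : ∀ (k : ℤ) (w : N), k ≠ 0 → k • w ∈ ℤ ∙ r → w ∈ ℤ ∙ r) (hdvd : ∀ z, d ∣ L r z)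
    (hndvd : ¬ ∀ z, 2 * d ∣ L r z) :
    (L.restrict (L.orthogonal (ℤ ∙ r))).Equivalent
        (((pi fun _ : Fin m ↦ -e8Form).prod (hyperbolicSum 1)).prod
          (BilinForm.prod ((2 : ℤ) • ((1 : ℤ) • LinearMap.mul ℤ ℤ)) ((2 : ℤ) • ((-1 : ℤ) • LinearMap.mul ℤ ℤ)))) ∨
      (L.restrict (L.orthogonal (ℤ ∙ r))).Equivalent
        (((pi fun _ : Fin m ↦ -e8Form).prod (hyperbolicSum 1)).prod ((2 : ℤ) • hyperbolicSum 1)) := by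
  obtain ⟨hrℓ, hr', hrsat', hdvd', E⟩ := transport_of_isometryEquiv_restrict_orthogonal B hs e r
  exact (restrict_orthogonal_span_pair_equivalent_or_of_not_two_mul_dvd_rank B m hs he hu hrk hσ hd hℓ hℓsat hrℓ
    (hr'.trans hr) (hrsat' hrsat) ((hdvd' _).2 hdvd) (fun h ↦ hndvd ((hdvd' _).1 h))).imp E.trans E.trans

end Transport

section TransportDelta

variable (m : ℕ) {N : Type*} [AddCommGroup N] [Module.Free ℤ N] [Module.Finite ℤ N] {L : BilinForm ℤ N}

/-- **`div(r) = d`: `δ(r^⊥_L) = 1 ⟹ r^⊥_L ≅ U ⊕ mE₈(−1) ⊕ ⟨2⟩ ⊕ ⟨−2⟩`, `δ(r^⊥_L) = 0 ⟹ r^⊥_L ≅ U ⊕ U(2) ⊕ mE₈(−1)`**,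
for `L ≅ ℓ^⊥` as above. [cite: GritsenkoHulekSankaran2007Kodaira, §4 (arXiv numbering) proof of Prop. 4.6] [cite: GritsenkoHulekSankaran2008Proportionality, Prop. 2.4 (iii)] -/
theorem restrict_orthogonal_equivalent_of_isometryEquiv_restrict_orthogonal_of_deltaInvariant (hs : B.IsSymm)
    (he : B.IsEven) (hu : B.IsUnimodular) (hrk : finrank ℤ M = 8 * m + 6) (hσ : B.signature = -(8 * m : ℤ))
    {ℓ : M} {d : ℤ} (hd : 0 < d) (hℓ : B ℓ ℓ = 2 * d)
    (hℓsat : ∀ (k : ℤ) (w : M), k ≠ 0 → k • w ∈ ℤ ∙ ℓ → w ∈ ℤ ∙ ℓ)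
    (e : (B.restrict (B.orthogonal (ℤ ∙ ℓ))).IsometryEquiv L) {r : N} (hr : L r r = -(2 * d))
    (hrsat : ∀ (k : ℤ) (w : N), k ≠ 0 → k • w ∈ ℤ ∙ r → w ∈ ℤ ∙ r) (hdvd : ∀ z, d ∣ L r z)
    (hndvd : ¬ ∀ z, 2 * d ∣ L r z) :
    (∀ h₁ h₂ h₃, (L.restrict (L.orthogonal (ℤ ∙ r))).deltaInvariant h₁ h₂ h₃ = 1 →
      (L.restrict (L.orthogonal (ℤ ∙ r))).Equivalent
        (((pi fun _ : Fin m ↦ -e8Form).prod (hyperbolicSum 1)).prod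
          (BilinForm.prod ((2 : ℤ) • ((1 : ℤ) • LinearMap.mul ℤ ℤ)) ((2 : ℤ) • ((-1 : ℤ) • LinearMap.mul ℤ ℤ))))) ∧
    (∀ h₁ h₂ h₃, (L.restrict (L.orthogonal (ℤ ∙ r))).deltaInvariant h₁ h₂ h₃ = 0 →
      (L.restrict (L.orthogonal (ℤ ∙ r))).Equivalent
        (((pi fun _ : Fin m ↦ -e8Form).prod (hyperbolicSum 1)).prod ((2 : ℤ) • hyperbolicSum 1))) := by
  obtain ⟨hrℓ, hr', hrsat', hdvd', ⟨E⟩⟩ := transport_of_isometryEquiv_restrict_orthogonal B hs e r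
  have hdvd'' := (hdvd' _).2 hdvd
  have hndvd'' : ¬ ∀ w, B w ℓ = 0 → 2 * d ∣ B (e.symm r : M) w := fun h ↦ hndvd ((hdvd' _).1 h)
  obtain ⟨hKn, hKs, hKe, -⟩ := invariants_restrict_orthogonal_span_pair_of_neg_vector_rank B m hs he hu hrk hσ hd
    hℓ hℓsat hrℓ (hr'.trans hr) (hrsat' hrsat) hdvd''
  obtain ⟨h1, h0⟩ := restrict_orthogonal_span_pair_equivalent_of_deltaInvariant_rank B m hs he hu hrk hσ hd hℓ hℓsat
    hrℓ (hr'.trans hr) (hrsat' hrsat) hdvd'' hndvd''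
  exact ⟨fun h₁ h₂ h₃ hδ ↦ LinearMap.BilinForm.Equivalent.trans ⟨E⟩
      (h1 hKn hKs hKe ((E.deltaInvariant_eq h₁ h₂ h₃ hKn hKs hKe).trans hδ)),
    fun h₁ h₂ h₃ hδ ↦ LinearMap.BilinForm.Equivalent.trans ⟨E⟩
      (h0 hKn hKs hKe ((E.deltaInvariant_eq h₁ h₂ h₃ hKn hKs hKe).trans hδ))⟩

end TransportDelta

/-! ### §4 The standalone model `L_{2d}^{(m)} = mE₈(−1) ⊕ 2U ⊕ ⟨−2d⟩ = h^⊥ ⊂ mE₈(−1) ⊕ 3U` -/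

section Model

/-- `h = e₁ + d f₁` in the last hyperbolic summand of `R ⊕ U^{n+1}` has `h² = 2d` and the dual vector `f₁`:
`h · f₁ = 1`. [cite: Huybrechts2016K3, Ch. 14 Ex. 1.11 (i) ("`ℓ ↦ e + d f`")] -/
theorem prod_hyperbolicSum_succ_polarisation_apply {P : Type*} [AddCommGroup P] (R : BilinForm ℤ P) (n : ℕ)
    (d : ℤ) :
    (R.prod (hyperbolicSum (n + 1))) (0, (Pi.single 0 1, d • Pi.single 0 1)) (0, (Pi.single 0 1, d • Pi.single 0 1)) =
        2 * d ∧
      (R.prod (hyperbolicSum (n + 1))) (0, (Pi.single 0 1, d • Pi.single 0 1)) (0, (0, Pi.single 0 1)) = 1 := by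
  refine ⟨?_, ?_⟩ <;> simp [LinearMap.BilinForm.prod_apply, two_mul]

variable (m d : ℕ)

/-- **`h^⊥ ≅ L_{2d}^{(m)}`**: the orthogonal complement of `h = e₁ + d f₁` in `mE₈(−1) ⊕ 3U` is (isometric to) the
standalone model `mE₈(−1) ⊕ 2U ⊕ ⟨−2d⟩`. [cite: GritsenkoHulekSankaran2008Proportionality, §2 ("`L_{2d}^{(m)} = 2U ⊕ mE₈(−1) ⊕ ⟨−2d⟩`")] [cite: Huybrechts2016K3, Ch. 14 Ex. 1.11 (i)] -/
theorem restrict_orthogonal_pi_neg_e8Form_prod_hyperbolicSum_three_equivalent_latticeL2dm :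
    (((pi fun _ : Fin m ↦ -e8Form).prod (hyperbolicSum 3)).restrict
        (((pi fun _ : Fin m ↦ -e8Form).prod (hyperbolicSum 3)).orthogonal
          (ℤ ∙ ((0, (Pi.single 0 1, (d : ℤ) • Pi.single 0 1)) :
            (Fin m → Fin 8 → ℤ) × ((Fin 3 → ℤ) × (Fin 3 → ℤ)))))).Equivalent
      (((pi fun _ : Fin m ↦ -e8Form).prod (hyperbolicSum 2)).prod ((-(2 * d : ℤ)) • LinearMap.mul ℤ ℤ)) := by
  obtain ⟨hs, he, hu, -⟩ := pi_neg_e8Form_prod_hyperbolicSum_invariants m 3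
  obtain ⟨hp, hn⟩ := sigPos_sigNeg_pi_neg_e8Form_prod_hyperbolicSum m 3
  obtain ⟨hℓd, hℓf⟩ := prod_hyperbolicSum_succ_polarisation_apply (pi fun _ : Fin m ↦ -e8Form) 2 (d : ℤ)
  exact restrict_orthogonal_equivalent_of_equivalent_prod_hyperbolicForm _ hs hu he (by omega) (by omega)
    (prod_hyperbolicSum_succ_equivalent _ 2) hℓd (ne_zero_of_apply_eq_one hℓf)
    fun k w hk hw ↦ mem_span_singleton_of_smul_mem_of_apply_eq_one hℓf hk hw

/-- The ambient data of the model: `Λ = mE₈(−1) ⊕ 3U` is even unimodular of rank `8m + 6` and signature `−8m`,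
and `h = e₁ + d f₁` is primitive with `h² = 2d`. [cite: GritsenkoHulekSankaran2008Proportionality, §2] [cite: Huybrechts2016K3, Ch. 14 Ex. 1.11 (i)] -/
theorem pi_neg_e8Form_prod_hyperbolicSum_three_polarisation_invariants :
    ((pi fun _ : Fin m ↦ -e8Form).prod (hyperbolicSum 3)).IsSymm ∧
    ((pi fun _ : Fin m ↦ -e8Form).prod (hyperbolicSum 3)).IsEven ∧
    ((pi fun _ : Fin m ↦ -e8Form).prod (hyperbolicSum 3)).IsUnimodular ∧
    finrank ℤ ((Fin m → Fin 8 → ℤ) × ((Fin 3 → ℤ) × (Fin 3 → ℤ))) = 8 * m + 6 ∧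
    ((pi fun _ : Fin m ↦ -e8Form).prod (hyperbolicSum 3)).signature = -(8 * m : ℤ) ∧
    ((pi fun _ : Fin m ↦ -e8Form).prod (hyperbolicSum 3)) (0, (Pi.single 0 1, (d : ℤ) • Pi.single 0 1))
        (0, (Pi.single 0 1, (d : ℤ) • Pi.single 0 1)) = 2 * d ∧
    ∀ (k : ℤ) (w : (Fin m → Fin 8 → ℤ) × ((Fin 3 → ℤ) × (Fin 3 → ℤ))), k ≠ 0 →
      k • w ∈ ℤ ∙ ((0, (Pi.single 0 1, (d : ℤ) • Pi.single 0 1)) : (Fin m → Fin 8 → ℤ) × ((Fin 3 → ℤ) × (Fin 3 → ℤ))) →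
      w ∈ ℤ ∙ ((0, (Pi.single 0 1, (d : ℤ) • Pi.single 0 1)) : (Fin m → Fin 8 → ℤ) × ((Fin 3 → ℤ) × (Fin 3 → ℤ))) := by
  obtain ⟨hs, he, hu, hσ⟩ := pi_neg_e8Form_prod_hyperbolicSum_invariants m 3
  obtain ⟨hℓd, hℓf⟩ := prod_hyperbolicSum_succ_polarisation_apply (pi fun _ : Fin m ↦ -e8Form) 2 (d : ℤ)
  have hrk := finrank_pi_e8Form_prod_hyperbolicSum_carrier m 3
  exact ⟨hs, he, hu, by omega, hσ, hℓd, fun k w hk hw ↦ mem_span_singleton_of_smul_mem_of_apply_eq_one hℓf hk hw⟩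

/-- **GHS Prop. 2.4 (iii), `div(r) = 2d`, in the standalone model**: for `r ∈ L_{2d}^{(m)} = mE₈(−1) ⊕ 2U ⊕ ⟨−2d⟩`
primitive with `r² = −2d` and `div(r) = 2d`, `r^⊥ ≅ 2U ⊕ mE₈(−1) = II_{2,8m+2}`.
[cite: GritsenkoHulekSankaran2008Proportionality, Prop. 2.4 (iii) ("The orthogonal complement of a `−2d`-vector `r` in `L_{2d}^{(m)}` is isometric to `II_{2,8m+2} = 2U ⊕ mE₈(−1)` if `div(r) = 2d`")] [cite: GritsenkoHulekSankaran2007Kodaira, §4 (arXiv numbering) Prop. 4.6] -/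
theorem restrict_orthogonal_latticeL2dm_equivalent_neg_twoMul_of_divisor_twoMul (hd : 0 < d)
    {r : ((Fin m → Fin 8 → ℤ) × ((Fin 2 → ℤ) × (Fin 2 → ℤ))) × ℤ}
    (hr : (((pi fun _ : Fin m ↦ -e8Form).prod (hyperbolicSum 2)).prod ((-(2 * d : ℤ)) • LinearMap.mul ℤ ℤ)) r r =
      -(2 * d : ℤ))
    (hsat : ∀ (k : ℤ) (w : ((Fin m → Fin 8 → ℤ) × ((Fin 2 → ℤ) × (Fin 2 → ℤ))) × ℤ), k ≠ 0 → k • w ∈ ℤ ∙ r →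
      w ∈ ℤ ∙ r)
    (h2d : ∀ z, (2 * d : ℤ) ∣
      (((pi fun _ : Fin m ↦ -e8Form).prod (hyperbolicSum 2)).prod ((-(2 * d : ℤ)) • LinearMap.mul ℤ ℤ)) r z) :
    ((((pi fun _ : Fin m ↦ -e8Form).prod (hyperbolicSum 2)).prod ((-(2 * d : ℤ)) • LinearMap.mul ℤ ℤ)).restrict
        ((((pi fun _ : Fin m ↦ -e8Form).prod (hyperbolicSum 2)).prod ((-(2 * d : ℤ)) • LinearMap.mul ℤ ℤ)).orthogonal
          (ℤ ∙ r))).Equivalent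
      ((pi fun _ : Fin m ↦ -e8Form).prod (hyperbolicSum 2)) := by
  obtain ⟨e⟩ := restrict_orthogonal_pi_neg_e8Form_prod_hyperbolicSum_three_equivalent_latticeL2dm m d
  obtain ⟨hs, he, hu, hrk, hσ, hℓd, hℓsat⟩ := pi_neg_e8Form_prod_hyperbolicSum_three_polarisation_invariants m d
  exact restrict_orthogonal_equivalent_of_isometryEquiv_restrict_orthogonal_of_two_mul_dvd _ m hs he hu hrk hσ
    (by omega) hℓd hℓsat e hr hsat h2d

/-- **GHS Prop. 2.4 (iii), `div(r) = d`, in the standalone model**: for `r ∈ L_{2d}^{(m)}` primitive with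
`r² = −2d`, `d ∣ (r, L)` and `div(r) ≠ 2d`, `r^⊥ ≅ K_2^{(m)} = U ⊕ mE₈(−1) ⊕ ⟨2⟩ ⊕ ⟨−2⟩` or
`r^⊥ ≅ T_{2,8m+2} = U ⊕ U(2) ⊕ mE₈(−1)`.
[cite: GritsenkoHulekSankaran2008Proportionality, Prop. 2.4 (iii) ("and to `K_2^{(m)} = U ⊕ mE₈(−1) ⊕ ⟨2⟩ ⊕ ⟨−2⟩` or `T_{2,8m+2} = U ⊕ U(2) ⊕ mE₈(−1)` if `div(r) = d`")] [cite: GritsenkoHulekSankaran2007Kodaira, §4 (arXiv numbering) Prop. 4.6] -/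
theorem restrict_orthogonal_latticeL2dm_equivalent_or_neg_twoMul_of_divisor (hd : 0 < d)
    {r : ((Fin m → Fin 8 → ℤ) × ((Fin 2 → ℤ) × (Fin 2 → ℤ))) × ℤ}
    (hr : (((pi fun _ : Fin m ↦ -e8Form).prod (hyperbolicSum 2)).prod ((-(2 * d : ℤ)) • LinearMap.mul ℤ ℤ)) r r =
      -(2 * d : ℤ))
    (hsat : ∀ (k : ℤ) (w : ((Fin m → Fin 8 → ℤ) × ((Fin 2 → ℤ) × (Fin 2 → ℤ))) × ℤ), k ≠ 0 → k • w ∈ ℤ ∙ r →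
      w ∈ ℤ ∙ r)
    (hdvd : ∀ z, (d : ℤ) ∣
      (((pi fun _ : Fin m ↦ -e8Form).prod (hyperbolicSum 2)).prod ((-(2 * d : ℤ)) • LinearMap.mul ℤ ℤ)) r z)
    (hndvd : ¬ ∀ z, (2 * d : ℤ) ∣
      (((pi fun _ : Fin m ↦ -e8Form).prod (hyperbolicSum 2)).prod ((-(2 * d : ℤ)) • LinearMap.mul ℤ ℤ)) r z) :
    ((((pi fun _ : Fin m ↦ -e8Form).prod (hyperbolicSum 2)).prod ((-(2 * d : ℤ)) • LinearMap.mul ℤ ℤ)).restrict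
        ((((pi fun _ : Fin m ↦ -e8Form).prod (hyperbolicSum 2)).prod ((-(2 * d : ℤ)) • LinearMap.mul ℤ ℤ)).orthogonal
          (ℤ ∙ r))).Equivalent
        (((pi fun _ : Fin m ↦ -e8Form).prod (hyperbolicSum 1)).prod
          (BilinForm.prod ((2 : ℤ) • ((1 : ℤ) • LinearMap.mul ℤ ℤ)) ((2 : ℤ) • ((-1 : ℤ) • LinearMap.mul ℤ ℤ)))) ∨
      ((((pi fun _ : Fin m ↦ -e8Form).prod (hyperbolicSum 2)).prod ((-(2 * d : ℤ)) • LinearMap.mul ℤ ℤ)).restrict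
        ((((pi fun _ : Fin m ↦ -e8Form).prod (hyperbolicSum 2)).prod ((-(2 * d : ℤ)) • LinearMap.mul ℤ ℤ)).orthogonal
          (ℤ ∙ r))).Equivalent
        (((pi fun _ : Fin m ↦ -e8Form).prod (hyperbolicSum 1)).prod ((2 : ℤ) • hyperbolicSum 1)) := by
  obtain ⟨e⟩ := restrict_orthogonal_pi_neg_e8Form_prod_hyperbolicSum_three_equivalent_latticeL2dm m d
  obtain ⟨hs, he, hu, hrk, hσ, hℓd, hℓsat⟩ := pi_neg_e8Form_prod_hyperbolicSum_three_polarisation_invariants m d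
  exact restrict_orthogonal_equivalent_or_of_isometryEquiv_restrict_orthogonal_of_not_two_mul_dvd _ m hs he hu hrk
    hσ (by omega) hℓd hℓsat e hr hsat hdvd hndvd

/-- **GHS Prop. 2.4 (iii), `div(r) = d`, the alternative told by `δ`**, in the standalone model:
`δ(r^⊥) = 1 ⟹ r^⊥ ≅ K_2^{(m)}`, `δ(r^⊥) = 0 ⟹ r^⊥ ≅ T_{2,8m+2}`.
[cite: GritsenkoHulekSankaran2008Proportionality, Prop. 2.4 (iii)] [cite: GritsenkoHulekSankaran2007Kodaira, §4 (arXiv numbering) proof of Prop. 4.6 ("`S_r ≅ U(2)` if `δ_{S_r} = 0`, `⟨2⟩ ⊕ ⟨−2⟩` if `δ_{S_r} = 1`")] -/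
theorem restrict_orthogonal_latticeL2dm_equivalent_neg_twoMul_of_deltaInvariant (hd : 0 < d)
    {r : ((Fin m → Fin 8 → ℤ) × ((Fin 2 → ℤ) × (Fin 2 → ℤ))) × ℤ}
    (hr : (((pi fun _ : Fin m ↦ -e8Form).prod (hyperbolicSum 2)).prod ((-(2 * d : ℤ)) • LinearMap.mul ℤ ℤ)) r r =
      -(2 * d : ℤ))
    (hsat : ∀ (k : ℤ) (w : ((Fin m → Fin 8 → ℤ) × ((Fin 2 → ℤ) × (Fin 2 → ℤ))) × ℤ), k ≠ 0 → k • w ∈ ℤ ∙ r →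
      w ∈ ℤ ∙ r)
    (hdvd : ∀ z, (d : ℤ) ∣
      (((pi fun _ : Fin m ↦ -e8Form).prod (hyperbolicSum 2)).prod ((-(2 * d : ℤ)) • LinearMap.mul ℤ ℤ)) r z)
    (hndvd : ¬ ∀ z, (2 * d : ℤ) ∣
      (((pi fun _ : Fin m ↦ -e8Form).prod (hyperbolicSum 2)).prod ((-(2 * d : ℤ)) • LinearMap.mul ℤ ℤ)) r z) :
    (∀ h₁ h₂ h₃, ((((pi fun _ : Fin m ↦ -e8Form).prod (hyperbolicSum 2)).prod
        ((-(2 * d : ℤ)) • LinearMap.mul ℤ ℤ)).restrict ((((pi fun _ : Fin m ↦ -e8Form).prod (hyperbolicSum 2)).prod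
          ((-(2 * d : ℤ)) • LinearMap.mul ℤ ℤ)).orthogonal (ℤ ∙ r))).deltaInvariant h₁ h₂ h₃ = 1 →
      ((((pi fun _ : Fin m ↦ -e8Form).prod (hyperbolicSum 2)).prod ((-(2 * d : ℤ)) • LinearMap.mul ℤ ℤ)).restrict
        ((((pi fun _ : Fin m ↦ -e8Form).prod (hyperbolicSum 2)).prod ((-(2 * d : ℤ)) • LinearMap.mul ℤ ℤ)).orthogonal
          (ℤ ∙ r))).Equivalent
        (((pi fun _ : Fin m ↦ -e8Form).prod (hyperbolicSum 1)).prod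
          (BilinForm.prod ((2 : ℤ) • ((1 : ℤ) • LinearMap.mul ℤ ℤ)) ((2 : ℤ) • ((-1 : ℤ) • LinearMap.mul ℤ ℤ))))) ∧
    (∀ h₁ h₂ h₃, ((((pi fun _ : Fin m ↦ -e8Form).prod (hyperbolicSum 2)).prod
        ((-(2 * d : ℤ)) • LinearMap.mul ℤ ℤ)).restrict ((((pi fun _ : Fin m ↦ -e8Form).prod (hyperbolicSum 2)).prod
          ((-(2 * d : ℤ)) • LinearMap.mul ℤ ℤ)).orthogonal (ℤ ∙ r))).deltaInvariant h₁ h₂ h₃ = 0 →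
      ((((pi fun _ : Fin m ↦ -e8Form).prod (hyperbolicSum 2)).prod ((-(2 * d : ℤ)) • LinearMap.mul ℤ ℤ)).restrict
        ((((pi fun _ : Fin m ↦ -e8Form).prod (hyperbolicSum 2)).prod ((-(2 * d : ℤ)) • LinearMap.mul ℤ ℤ)).orthogonal
          (ℤ ∙ r))).Equivalent
        (((pi fun _ : Fin m ↦ -e8Form).prod (hyperbolicSum 1)).prod ((2 : ℤ) • hyperbolicSum 1))) := by
  obtain ⟨e⟩ := restrict_orthogonal_pi_neg_e8Form_prod_hyperbolicSum_three_equivalent_latticeL2dm m d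
  obtain ⟨hs, he, hu, hrk, hσ, hℓd, hℓsat⟩ := pi_neg_e8Form_prod_hyperbolicSum_three_polarisation_invariants m d
  exact restrict_orthogonal_equivalent_of_isometryEquiv_restrict_orthogonal_of_deltaInvariant _ m hs he hu hrk hσ
    (by omega) hℓd hℓsat e hr hsat hdvd hndvd

end Model

end Literature.Topology.FourManifolds

end
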